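import Literature.Analysis.FunctionSpaces.TorusHardCoreCutoff
import HarnessLib

/-!
# Bose symmetry of the pair cut-off

Analysis/FunctionSpaces support file (everything proved; no definitions, no named facts). The product
cut-off `Torus.pairCutoff θ r δ t = ∏_{i<j} θ((ρᵢⱼ(t) - r)/δ)` of `TorusHardCoreCutoff` is invariant
under relabelling the particles, `t ↦ (p ↦ t (σ p.1, p.2))` for `σ ∈ Perm (Fin N)`
(`Torus.pairCutoff_comp_perm`): the pair distance is symmetric (`pairDist_comm`) and a product over
the pairs `i < j` of a symmetric function of the pair is invariant under relabelling
(`Torus.prod_pairs_comp_perm`, the bijection `{i<j} → {i<j}`, `(i,j) ↦ sort (σ i, σ j)`). Hence the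
cut-off of a Bose-symmetric function is Bose-symmetric — the symmetry clause of the admissible trial
states of the periodic Bose gas (`PeriodicTrialState.symm`).

## Mathlib / tree search

Mathlib: `Finset.prod_nbij'`; tree: `Torus.pairCutoff`, `Torus.pairDist_comm`.
-/

noncomputable section

open Set Function UnitAddTorus

namespace Literature.Analysis.FunctionSpaces

namespace Torus

variable {N : ℕ}

/-- **A product over the pairs `i < j` of a symmetric function of the pair is invariant under
relabelling** by a permutation `σ`. [folklore] -/
theorem prod_pairs_comp_perm {M : Type*} [CommMonoid M] {f : Fin N → Fin N → M} (hf : ∀ a b, f a b = f b a)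
    (σ : Equiv.Perm (Fin N)) :
    ∏ q ∈ (Finset.univ : Finset (Fin N × Fin N)).filter (fun q => q.1 < q.2), f (σ q.1) (σ q.2) =
      ∏ q ∈ (Finset.univ : Finset (Fin N × Fin N)).filter (fun q => q.1 < q.2), f q.1 q.2 := by
  classical
  -- the bijection of ordered pairs `q ↦ sort (σ q.1, σ q.2)`
  refine Finset.prod_nbij' (fun q => if σ q.1 < σ q.2 then (σ q.1, σ q.2) else (σ q.2, σ q.1))
    (fun q => if σ.symm q.1 < σ.symm q.2 then (σ.symm q.1, σ.symm q.2) else (σ.symm q.2, σ.symm q.1))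
    ?_ ?_ ?_ ?_ ?_
  · intro q hq
    have hq' : q.1 < q.2 := (Finset.mem_filter.1 hq).2
    have hne : σ q.1 ≠ σ q.2 := fun h => hq'.ne (σ.injective h)
    simp only [Finset.mem_filter, Finset.mem_univ, true_and]
    split_ifs with h
    · exact h
    · exact lt_of_le_of_ne (not_lt.1 h) (Ne.symm hne)
  · intro q hq
    have hq' : q.1 < q.2 := (Finset.mem_filter.1 hq).2
    have hne : σ.symm q.1 ≠ σ.symm q.2 := fun h => hq'.ne (σ.symm.injective h)
    simp only [Finset.mem_filter, Finset.mem_univ, true_and]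
    split_ifs with h
    · exact h
    · exact lt_of_le_of_ne (not_lt.1 h) (Ne.symm hne)
  · intro q hq
    have hq' : q.1 < q.2 := (Finset.mem_filter.1 hq).2
    by_cases h : σ q.1 < σ q.2
    · simp [h, hq']
    · simp only [h, if_false, Equiv.symm_apply_apply]
      rw [if_neg (not_lt.2 hq'.le)]
  · intro q hq
    have hq' : q.1 < q.2 := (Finset.mem_filter.1 hq).2
    by_cases h : σ.symm q.1 < σ.symm q.2
    · simp [h, hq']
    · simp only [h, if_false, Equiv.apply_symm_apply]
      rw [if_neg (not_lt.2 hq'.le)]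
  · intro q _
    by_cases h : σ q.1 < σ q.2
    · simp [h]
    · simp only [h, if_false]
      exact hf _ _

/-- Relabelling the particles relabels the pair distances. [folklore] -/
theorem pairDist_comp_perm (i j : Fin N) (t : UnitAddTorus (Fin N × Fin 3)) (σ : Equiv.Perm (Fin N)) :
    pairDist i j (fun p : Fin N × Fin 3 => t (σ p.1, p.2)) = pairDist (σ i) (σ j) t := rfl

/-- **Bose symmetry of the pair cut-off**: relabelling the particles does not change
`∏_{i<j} θ((ρᵢⱼ - r)/δ)` (any profile; `ρᵢⱼ = ρⱼᵢ`). [folklore] -/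
theorem pairCutoff_comp_perm (θ : ℝ → ℝ) (r δ : ℝ) (t : UnitAddTorus (Fin N × Fin 3)) (σ : Equiv.Perm (Fin N)) :
    pairCutoff θ r δ (fun p : Fin N × Fin 3 => t (σ p.1, p.2)) = pairCutoff θ r δ t := by
  unfold pairCutoff
  simp_rw [pairDist_comp_perm]
  exact prod_pairs_comp_perm (f := fun a b => θ ((pairDist a b t - r) / δ)) (fun a b => by rw [pairDist_comm]) σ

end Torus

end Literature.Analysis.FunctionSpaces

end
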